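import Summits.QuantumFields.QCD.Theses.GradientFlowSpecies

/-!
# `GradientFlowSpecies.OffsetShift` (item stmt-QuantumFields-8924) — proved

The offset trick shared by the assemblies of routes `GradientFlowSpecies` and `HeatSlicedQuarks` (crux
`RobustYangMillsHandover`, the PIN of its lines): shifting the flavour-blind critical bare mass of a
`QCDRegularisation` by `a_k · M / Z_m(k)` realises the renormalised mass tuple `m` exactly as the original
regularisation realises `m + M` — both schemes have bare masses `m_crit(k) + a_k (m_f + M) / Z_m(k)`, and every
other field of the scheme (`a, β, L, z, shift`) is untouched.  Definitional (structure eta + `ring`).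
Source: Montvay–Münster 1994, §5.1 (Wilson quark masses, critical hopping parameter).
-/

namespace Summit.QuantumFields.QCD.Theorems

open Literature.MathematicalPhysics.QuantumFieldTheory

/-- **Item stmt-QuantumFields-8924 `OffsetShift`, proved**: for every regularisation `reg`, offset `M`, mass
tuple `m` and species renormalisations `(z, shift)`, the regularisation with critical mass
`m_crit(k) + a_k M / Z_m(k)` has, at the tuple `m`, literally the scheme of `reg` at the tuple `m + M`.
[cite: MontvayMunster1994, §5.1] -/
theorem offsetShift_proof : Summit.QuantumFields.QCD.Theses.GradientFlowSpecies.OffsetShift := by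
  intro Nf reg M m z shift
  simp only [QCDRegularisation.scheme, QCDScheme.mk.injEq, true_and, and_true]
  funext f k
  ring

end Summit.QuantumFields.QCD.Theorems
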